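import Summits.BirchSwinnertonDyer.BirchSwinnertonDyer.Theorems.SylvesterTwoHeegnerIndexOneBitAbsorption
import Summits.BirchSwinnertonDyer.BirchSwinnertonDyer.Theorems.SylvesterTwoHeegnerIndexLowerOfFactsStrata
import HarnessLib

/-!
# Route `SylvesterTwoHeegnerIndex` (rung K7t), crux `HeegnerIndexLowerAtTwoHSYOfFacts` (item 19477,
# the facts-conditional twin of 19230): the LOSSLESS `𝒱₀` / off-`𝒱₀` SPLIT PACKAGE of the LOWER half
# (helper toward stmt-BirchSwinnertonDyer-19477; cell «bsd-cm», seat `bsd-cm-k7t-c3` gen 6; theorems only)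

HONEST FRAMING (cell «bsd-cm», `run/shared/lean/pub/bsd-cm/`; FULL-BSD RANK ≤ 1 programme). The
class 𝒞_HSY at `p = 2` (`BSD(E_p, 2)`, `E_p : x³ + y³ = p`, `p ≡ 4, 7 (mod 9)` prime, `3 ∉ 𝔽_p^{×3}`)
is OPEN in print and stays open here. Item 19477 is, modulo the route's support item, the
main-conjecture half `ord₂ #Ш_an(E_p) ≤ ord₂ #Ш(E_p)` on the whole family (p417655), i.e. an UPPER
bound on the `ℤ₂[ω]`-divisibility of Hu–Shu–Yin's Heegner point by `Ш(E_p)·Ш(E_{3p²})`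
(Kolyvagin-conjecture direction at the inert prime `2`; cell memo two §22.3/§23: no anchor in print).
THEOREMS ONLY (0 definitions, 0 named facts, 0 `sorry`); nothing here proves the crux or a child.

WHAT THIS FILE ADDS. The UPPER crux was split (19476 → 19580/19581 + glue 19582; facts-plus twin
19725 → 19802/19803/19804 + glue 19805) into a `𝒱₀` layer and an off-`𝒱₀` layer, `𝒱₀` = {pairs
`(B ≅ E_p, A ≅ E_{3p²})` with `#Ш(B)[2^∞] = #Ш(A)[2^∞] = 1`}. The LOWER crux 19477 has no split yet
(planner: «19477 wants either your split … for a BC5 structure»). This file is that split, with a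
proof that it is LOSSLESS:
§1 `lowerOfFacts_iff_onV0_and_offV0` — 19477 ⟺ (𝒱₀ child) ∧ (off-𝒱₀ child), both children in
   Miller's per-curve currency `MissingLowerBoundAt B 2` (the mirror of `UpperOffV0HSY(Plus)`), and the
   glue term `lowerOfFacts_of_onV0_of_offV0` (children ⟹ parent) a would-be glue item closes by.
§2 The children's CONTENT: the `𝒱₀` child ⟺ «granted the facts, on `𝒱₀` the pair product
   `#Ш_an(E_p)·#Ш_an(E_{3p²})` has `ord₂ ≤ 0`» ⟺ «on `𝒱₀`, `ord₂ #Ш_an(E_p) ≤ 0`» (Hu–Shu–Yin's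
   point has at most the predicted `2`-divisibility where both `2`-Selmer groups are minimal —
   memo two N7/R78, OPEN); the off-`𝒱₀` child ⟺ the pair bound `ord₂(qB·qA) ≤ ord₂#Ш(B)[2^∞] +
   ord₂#Ш(A)[2^∞]` off `𝒱₀` (p457106's displayed `hoff`; OPEN; first informative rows = the 79
   `(ℤ/4)²`-members `p ≤ 4·10⁵`, all consistent, CERT79).
§3 Under the route's pair parity `TwoAdicPairHSY` (19580, by name; closes on `p ≡ 4 (9)` from the
   printed display and on `p ≡ 7 (9)` from THEOREM C): the `𝒱₀` child ⟺ «`n(p) = 0` on `𝒱₀`»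
   (p457106's displayed `hon`), and — with Cassels–Tate — each child already follows from its ONE-BIT
   weakening (p465001), so a split may state either form.
Everything is composition of landed theorems (p417655, p431798, p457106, p465001); the children are
displayed verbatim as hypotheses / sides of an `↔`, never asserted.

PARTITION (D-0054): CornerF at `2` / O12 × 𝒞_HSY (all members; census `p ≤ 4·10⁵`: 6617 `𝒱₀`-type
rows `[1,1,0]`, 797 + 79 off-`𝒱₀` rows on the `E_p` side; book230: 6 classes) × `p = 2` —
types-the-object-of (split package of the LOWER crux); closes no cell, no item; moves no label.
References (locators only): [HuShuYin2019] Thm. 1.3/1.4 (p. 3), Cor. 4.4, (bsd) p. 12;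
[BurungaleFlach2024] Thm. 1.1, Cor. 2; [Miller2011LMS] §1, Def. 1.1; [SilvermanAEC2009] Thm. X.4.14,
VIII.8 Cor. 8.3; [GrossZagier1986] I.(6.5), V.§2; parents p417655, p431798, p457106, p465001.
-/

set_option autoImplicit false
-- the Theorems namespace `Summit.BirchSwinnertonDyer.BirchSwinnertonDyer.…` repeats a component by design (D-0017 layout)
set_option linter.dupNamespace false

noncomputable section

open scoped Classical

open WeierstrassCurve NumberField Literature.NumberTheory.EllipticCurves
  Literature.NumberTheory.EllipticCurves.Rank1Residual
  Literature.NumberTheory.EllipticCurves.Rank1Residual.Typed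
  Literature.NumberTheory.EllipticCurves.HuShuYin2019
  Summit.BirchSwinnertonDyer.Rank1Residual
  Summit.BirchSwinnertonDyer.BirchSwinnertonDyer.Theses.SylvesterTwoHeegnerIndex

namespace Summit.BirchSwinnertonDyer.BirchSwinnertonDyer.Theorems

namespace SylvesterTwoLowerSplit

/-! ## §0 The partner exists -/

/-- A globally minimal model of the partner `E_{3p²}` exists (Silverman VIII.8.3 in the tree's
currency: `X12.CubeSumFamilies.exists_isGloballyMinimal_model`). [cite: SilvermanAEC2009, VIII.8 Cor. 8.3] -/
theorem exists_partner {p : ℕ} (hp : p.Prime) :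
    ∃ (A : WeierstrassCurve ℚ) (_ : A.IsElliptic) (_ : A.IsGloballyMinimal),
      ∃ C : VariableChange ℚ, C • A = cubeSumCurve (3 * (p : ℚ) ^ 2) := by
  have hn : (3 * (p : ℚ) ^ 2) ≠ 0 :=
    mul_ne_zero (by norm_num) (pow_ne_zero _ (Nat.cast_ne_zero.mpr hp.ne_zero))
  haveI := X12.CubeSumFamilies.isElliptic_cubeSumCurve hn
  obtain ⟨A, hAe, hAm, CA, hCA⟩ :=
    X12.CubeSumFamilies.exists_isGloballyMinimal_model (cubeSumCurve (3 * (p : ℚ) ^ 2))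
  exact ⟨A, hAe, hAm, CA, hCA⟩

/-! ## §1 The lossless split of item 19477 into a `𝒱₀` child and an off-`𝒱₀` child -/

/-- **THE SPLIT IS LOSSLESS.** `HeegnerIndexLowerAtTwoHSYOfFacts` (item 19477) holds iff BOTH
(𝒱₀ child) granted `PublishedFactsTwo`, every member/partner pair `(B ≅ E_p, A ≅ E_{3p²})` (globally
minimal) with `#Ш(B)[2^∞] = 1 ∧ #Ш(A)[2^∞] = 1` satisfies `MissingLowerBoundAt B 2`, AND
(off-𝒱₀ child) granted `PublishedFactsTwo`, every such pair with `¬(#Ш(B)[2^∞] = 1 ∧ #Ш(A)[2^∞] = 1)`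
satisfies `MissingLowerBoundAt B 2` — the exact mirror of the UPPER split 19476 → 19580/19581
(`UpperOffV0HSY`). (→: p417655/`lowerOfFacts_iff_forall_missingLowerBoundAt`, the partner and the
`𝒱₀`-condition being idle; ←: a minimal partner exists, then cases on `𝒱₀`.) Both children OPEN;
nothing asserted about them. [cite: Miller2011LMS, §1 and Def. 1.1]
[cite: HuShuYin2019, Thm. 1.3 and Thm. 1.4 (p. 3)] [cite: SilvermanAEC2009, VIII.8 Cor. 8.3] -/
theorem lowerOfFacts_iff_onV0_and_offV0 :
    HeegnerIndexLowerAtTwoHSYOfFacts ↔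
      ((PublishedFactsTwo → ∀ (p : ℕ), p.Prime → (p % 9 = 4 ∨ p % 9 = 7) →
        (¬ ∃ x : ZMod p, x ^ 3 = 3) →
        ∀ (A B : WeierstrassCurve ℚ) [A.IsElliptic] [A.IsGloballyMinimal] [B.IsElliptic]
          [B.IsGloballyMinimal], (∃ C : VariableChange ℚ, C • B = cubeSumCurve (p : ℚ)) →
          (∃ C : VariableChange ℚ, C • A = cubeSumCurve (3 * (p : ℚ) ^ 2)) →
          (Nat.card (AddCommGroup.primaryComponent B.sha 2) = 1 ∧
            Nat.card (AddCommGroup.primaryComponent A.sha 2) = 1) →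
          MissingLowerBoundAt B 2) ∧
      (PublishedFactsTwo → ∀ (p : ℕ), p.Prime → (p % 9 = 4 ∨ p % 9 = 7) →
        (¬ ∃ x : ZMod p, x ^ 3 = 3) →
        ∀ (A B : WeierstrassCurve ℚ) [A.IsElliptic] [A.IsGloballyMinimal] [B.IsElliptic]
          [B.IsGloballyMinimal], (∃ C : VariableChange ℚ, C • B = cubeSumCurve (p : ℚ)) →
          (∃ C : VariableChange ℚ, C • A = cubeSumCurve (3 * (p : ℚ) ^ 2)) →
          ¬ (Nat.card (AddCommGroup.primaryComponent B.sha 2) = 1 ∧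
            Nat.card (AddCommGroup.primaryComponent A.sha 2) = 1) →
          MissingLowerBoundAt B 2)) := by
  rw [SylvesterTwoLowerCert.lowerOfFacts_iff_forall_missingLowerBoundAt]
  refine ⟨fun h => ⟨fun hF p hp h9 h3 A B _ _ _ _ hB _ _ => h hF p hp h9 h3 B hB,
    fun hF p hp h9 h3 A B _ _ _ _ hB _ _ => h hF p hp h9 h3 B hB⟩, fun ⟨hon, hoff⟩ hF p hp h9 h3 B _ _ hB => ?_⟩
  obtain ⟨A, _, _, CA, hCA⟩ := exists_partner hp
  by_cases hV : Nat.card (AddCommGroup.primaryComponent B.sha 2) = 1 ∧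
      Nat.card (AddCommGroup.primaryComponent A.sha 2) = 1
  · exact hon hF p hp h9 h3 A B hB ⟨CA, hCA⟩ hV
  · exact hoff hF p hp h9 h3 A B hB ⟨CA, hCA⟩ hV

/-- **GLUE TERM (children ⟹ parent)** — what a glue item `HeegnerIndexLowerOfPartsHSY :=
LowerOnV0HSY → LowerOffV0HSY → HeegnerIndexLowerAtTwoHSYOfFacts` would close by (`.mpr` of the
lossless split). Composition only. [cite: Miller2011LMS, §1 and Def. 1.1] -/
theorem lowerOfFacts_of_onV0_of_offV0
    (hon : PublishedFactsTwo → ∀ (p : ℕ), p.Prime → (p % 9 = 4 ∨ p % 9 = 7) →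
      (¬ ∃ x : ZMod p, x ^ 3 = 3) →
      ∀ (A B : WeierstrassCurve ℚ) [A.IsElliptic] [A.IsGloballyMinimal] [B.IsElliptic]
        [B.IsGloballyMinimal], (∃ C : VariableChange ℚ, C • B = cubeSumCurve (p : ℚ)) →
        (∃ C : VariableChange ℚ, C • A = cubeSumCurve (3 * (p : ℚ) ^ 2)) →
        (Nat.card (AddCommGroup.primaryComponent B.sha 2) = 1 ∧
          Nat.card (AddCommGroup.primaryComponent A.sha 2) = 1) →
        MissingLowerBoundAt B 2)
    (hoff : PublishedFactsTwo → ∀ (p : ℕ), p.Prime → (p % 9 = 4 ∨ p % 9 = 7) →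
      (¬ ∃ x : ZMod p, x ^ 3 = 3) →
      ∀ (A B : WeierstrassCurve ℚ) [A.IsElliptic] [A.IsGloballyMinimal] [B.IsElliptic]
        [B.IsGloballyMinimal], (∃ C : VariableChange ℚ, C • B = cubeSumCurve (p : ℚ)) →
        (∃ C : VariableChange ℚ, C • A = cubeSumCurve (3 * (p : ℚ) ^ 2)) →
        ¬ (Nat.card (AddCommGroup.primaryComponent B.sha 2) = 1 ∧
          Nat.card (AddCommGroup.primaryComponent A.sha 2) = 1) →
        MissingLowerBoundAt B 2) :
    HeegnerIndexLowerAtTwoHSYOfFacts :=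
  lowerOfFacts_iff_onV0_and_offV0.mpr ⟨hon, hoff⟩

/-! ## §2 The content of each child (pair currency and single-curve currency) -/

section Content

variable {p : ℕ}

/-- **The `𝒱₀` child at a pair, pair currency.** Granted Hu–Shu–Yin, Burungale–Flach, modularity:
at a pair on `𝒱₀` (`#Ш(B)[2^∞] = #Ш(A)[2^∞] = 1`), `MissingLowerBoundAt B 2 ⟺ ord₂(#Ш_an(B)·#Ш_an(A))
≤ 0` — Hu–Shu–Yin's point is at most as `2`-divisible as predicted (`2(m(p) + i/2) ≤ 0`).
[cite: HuShuYin2019, Cor. 4.4 and (bsd) p. 12] [cite: BurungaleFlach2024, Thm. 1.1 and Cor. 2]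
[cite: Miller2011LMS, Def. 1.1] -/
theorem missingLowerBoundAt_iff_pairLeZero_onV0 (hHSY : thm14_threePart_product)
    (hCM0 : bsdTriple_of_hasCM_of_L_one_ne_zero) (hmod : hasEntireLFunction_rat)
    (hp : p.Prime) (h9 : p % 9 = 4 ∨ p % 9 = 7) (h3 : ¬ ∃ x : ZMod p, x ^ 3 = 3)
    (A B : WeierstrassCurve ℚ) [A.IsElliptic] [A.IsGloballyMinimal] [B.IsElliptic]
    [B.IsGloballyMinimal] (hB : ∃ C : VariableChange ℚ, C • B = cubeSumCurve (p : ℚ))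
    (hA : ∃ C : VariableChange ℚ, C • A = cubeSumCurve (3 * (p : ℚ) ^ 2))
    (hV : Nat.card (AddCommGroup.primaryComponent B.sha 2) = 1 ∧
      Nat.card (AddCommGroup.primaryComponent A.sha 2) = 1) :
    MissingLowerBoundAt B 2 ↔
      ∃ qB qA : ℚ, shaAn B = (qB : ℂ) ∧ shaAn A = (qA : ℂ) ∧ qB * qA ≠ 0 ∧
        padicValRat 2 (qB * qA) ≤ 0 := by
  rw [SylvesterTwoUpper.missingLowerBoundAt_iff_pairBound hHSY hCM0 hmod hp h9 h3 A B hB hA, hV.1, hV.2]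
  simp only [padicValNat_one_right, Nat.cast_zero, add_zero]

/-- **The `𝒱₀` child at a pair, single-curve currency.** Same inputs: on `𝒱₀`,
`MissingLowerBoundAt B 2 ⟺ ord₂ #Ш_an(B) ≤ 0` (the partner's `ord₂ #Ш_an(A) = ord₂ #Ш(A)[2^∞] = 0`
cancels by Burungale–Flach). On a `[1,1,0]`-row this is «`#Ш_an(E_p)` is `2`-integral-free», the
per-member falsification test of CERT rows. [cite: HuShuYin2019, Thm. 1.3 and Thm. 1.4 (p. 3)]
[cite: BurungaleFlach2024, Thm. 1.1 and Cor. 2] [cite: Miller2011LMS, Def. 1.1] -/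
theorem missingLowerBoundAt_iff_shaAn_leZero_onV0 (hHSY : thm14_threePart_product)
    (hCM0 : bsdTriple_of_hasCM_of_L_one_ne_zero) (hmod : hasEntireLFunction_rat)
    (hp : p.Prime) (h9 : p % 9 = 4 ∨ p % 9 = 7) (h3 : ¬ ∃ x : ZMod p, x ^ 3 = 3)
    (A B : WeierstrassCurve ℚ) [A.IsElliptic] [A.IsGloballyMinimal] [B.IsElliptic]
    [B.IsGloballyMinimal] (hB : ∃ C : VariableChange ℚ, C • B = cubeSumCurve (p : ℚ))
    (hA : ∃ C : VariableChange ℚ, C • A = cubeSumCurve (3 * (p : ℚ) ^ 2))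
    (hV : Nat.card (AddCommGroup.primaryComponent B.sha 2) = 1 ∧
      Nat.card (AddCommGroup.primaryComponent A.sha 2) = 1) :
    MissingLowerBoundAt B 2 ↔ ∃ qB : ℚ, shaAn B = (qB : ℂ) ∧ qB ≠ 0 ∧ padicValRat 2 qB ≤ 0 := by
  haveI : Fact (Nat.Prime 2) := ⟨Nat.prime_two⟩
  obtain ⟨-, -, qB, qA, hqB, hqA, hqB0, hqA0, hvA⟩ :=
    SylvesterTwoUpper.pair_shaAn_two hHSY hCM0 hmod hp h9 h3 A B hB hA
  have hvA0 : padicValRat 2 qA = 0 := by rw [hvA, hV.2, padicValNat_one_right, Nat.cast_zero]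
  rw [missingLowerBoundAt_iff_pairLeZero_onV0 hHSY hCM0 hmod hp h9 h3 A B hB hA hV]
  constructor
  · rintro ⟨qB', qA', hqB', hqA', -, hle⟩
    have hqq : qB' = qB := by exact_mod_cast hqB'.symm.trans hqB
    have hqq' : qA' = qA := by exact_mod_cast hqA'.symm.trans hqA
    subst hqq hqq'
    refine ⟨qB', hqB, hqB0, ?_⟩
    rw [padicValRat.mul hqB0 hqA0, hvA0, add_zero] at hle
    exact hle
  · rintro ⟨qB', hqB', -, hle⟩
    have hqq : qB' = qB := by exact_mod_cast hqB'.symm.trans hqB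
    subst hqq
    refine ⟨qB', qA, hqB, hqA, mul_ne_zero hqB0 hqA0, ?_⟩
    rw [padicValRat.mul hqB0 hqA0, hvA0, add_zero]
    exact hle

end Content

/-- **THE `𝒱₀` CHILD ⟺ «pair product has `ord₂ ≤ 0` on `𝒱₀`»** (class-wide, granted the facts):
the `𝒱₀` child of §1 in Hu–Shu–Yin's pair currency. OPEN; nothing asserted (content: where both
`2`-Selmer groups are minimal, the `ℤ₂[ω]`-index of Hu–Shu–Yin's point is minimal — memo two N7/R78).
[cite: HuShuYin2019, Cor. 4.4 and (bsd) p. 12] [cite: BurungaleFlach2024, Thm. 1.1 and Cor. 2]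
[cite: Miller2011LMS, Def. 1.1] -/
theorem lowerOnV0_iff_pairLeZero :
    (PublishedFactsTwo → ∀ (p : ℕ), p.Prime → (p % 9 = 4 ∨ p % 9 = 7) →
        (¬ ∃ x : ZMod p, x ^ 3 = 3) →
        ∀ (A B : WeierstrassCurve ℚ) [A.IsElliptic] [A.IsGloballyMinimal] [B.IsElliptic]
          [B.IsGloballyMinimal], (∃ C : VariableChange ℚ, C • B = cubeSumCurve (p : ℚ)) →
          (∃ C : VariableChange ℚ, C • A = cubeSumCurve (3 * (p : ℚ) ^ 2)) →
          (Nat.card (AddCommGroup.primaryComponent B.sha 2) = 1 ∧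
            Nat.card (AddCommGroup.primaryComponent A.sha 2) = 1) →
          MissingLowerBoundAt B 2) ↔
      (PublishedFactsTwo → ∀ (p : ℕ), p.Prime → (p % 9 = 4 ∨ p % 9 = 7) →
        (¬ ∃ x : ZMod p, x ^ 3 = 3) →
        ∀ (A B : WeierstrassCurve ℚ) [A.IsElliptic] [A.IsGloballyMinimal] [B.IsElliptic]
          [B.IsGloballyMinimal], (∃ C : VariableChange ℚ, C • B = cubeSumCurve (p : ℚ)) →
          (∃ C : VariableChange ℚ, C • A = cubeSumCurve (3 * (p : ℚ) ^ 2)) →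
          (Nat.card (AddCommGroup.primaryComponent B.sha 2) = 1 ∧
            Nat.card (AddCommGroup.primaryComponent A.sha 2) = 1) →
          ∃ qB qA : ℚ, shaAn B = (qB : ℂ) ∧ shaAn A = (qA : ℂ) ∧ qB * qA ≠ 0 ∧
            padicValRat 2 (qB * qA) ≤ 0) := by
  refine ⟨fun h hF p hp h9 h3 A B _ _ _ _ hB hA hV => ?_, fun h hF p hp h9 h3 A B _ _ _ _ hB hA hV => ?_⟩
  · have hF' := hF
    obtain ⟨hHSY, hCM0, hmod, -⟩ := hF'
    exact (missingLowerBoundAt_iff_pairLeZero_onV0 hHSY hCM0 hmod hp h9 h3 A B hB hA hV).mp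
      (h hF p hp h9 h3 A B hB hA hV)
  · have hF' := hF
    obtain ⟨hHSY, hCM0, hmod, -⟩ := hF'
    exact (missingLowerBoundAt_iff_pairLeZero_onV0 hHSY hCM0 hmod hp h9 h3 A B hB hA hV).mpr
      (h hF p hp h9 h3 A B hB hA hV)

/-- **THE OFF-`𝒱₀` CHILD ⟺ the pair bound off `𝒱₀`** (p457106's displayed `hoff`): granted the
facts, every off-`𝒱₀` pair satisfies `ord₂(#Ш_an(B)·#Ш_an(A)) ≤ ord₂#Ш(B)[2^∞] + ord₂#Ш(A)[2^∞]` —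
«extra `2`-divisibility of Hu–Shu–Yin's point forces `Ш`» (`2n(p) ≤ s_B + s_A`). OPEN; first
informative rows are the `(ℤ/4)²`-members (CERT79: 77 × consistent with equality, 2 × `#Ш_an = 64`
awaiting an `8`-descent). [cite: HuShuYin2019, Cor. 4.4 and (bsd) p. 12]
[cite: BurungaleFlach2024, Thm. 1.1 and Cor. 2] [cite: Miller2011LMS, Def. 1.1] -/
theorem lowerOffV0_iff_pairBound :
    (PublishedFactsTwo → ∀ (p : ℕ), p.Prime → (p % 9 = 4 ∨ p % 9 = 7) →
        (¬ ∃ x : ZMod p, x ^ 3 = 3) →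
        ∀ (A B : WeierstrassCurve ℚ) [A.IsElliptic] [A.IsGloballyMinimal] [B.IsElliptic]
          [B.IsGloballyMinimal], (∃ C : VariableChange ℚ, C • B = cubeSumCurve (p : ℚ)) →
          (∃ C : VariableChange ℚ, C • A = cubeSumCurve (3 * (p : ℚ) ^ 2)) →
          ¬ (Nat.card (AddCommGroup.primaryComponent B.sha 2) = 1 ∧
            Nat.card (AddCommGroup.primaryComponent A.sha 2) = 1) →
          MissingLowerBoundAt B 2) ↔
      (PublishedFactsTwo → ∀ (p : ℕ), p.Prime → (p % 9 = 4 ∨ p % 9 = 7) →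
        (¬ ∃ x : ZMod p, x ^ 3 = 3) →
        ∀ (A B : WeierstrassCurve ℚ) [A.IsElliptic] [A.IsGloballyMinimal] [B.IsElliptic]
          [B.IsGloballyMinimal], (∃ C : VariableChange ℚ, C • B = cubeSumCurve (p : ℚ)) →
          (∃ C : VariableChange ℚ, C • A = cubeSumCurve (3 * (p : ℚ) ^ 2)) →
          ¬ (Nat.card (AddCommGroup.primaryComponent B.sha 2) = 1 ∧
            Nat.card (AddCommGroup.primaryComponent A.sha 2) = 1) →
          ∃ qB qA : ℚ, shaAn B = (qB : ℂ) ∧ shaAn A = (qA : ℂ) ∧ qB * qA ≠ 0 ∧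
            padicValRat 2 (qB * qA) ≤
              (padicValNat 2 (Nat.card (AddCommGroup.primaryComponent B.sha 2)) : ℤ) +
                (padicValNat 2 (Nat.card (AddCommGroup.primaryComponent A.sha 2)) : ℤ)) := by
  refine ⟨fun h hF p hp h9 h3 A B _ _ _ _ hB hA hV => ?_, fun h hF p hp h9 h3 A B _ _ _ _ hB hA hV => ?_⟩
  · have hF' := hF
    obtain ⟨hHSY, hCM0, hmod, -⟩ := hF'
    exact (SylvesterTwoUpper.missingLowerBoundAt_iff_pairBound hHSY hCM0 hmod hp h9 h3 A B hB hA).mp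
      (h hF p hp h9 h3 A B hB hA hV)
  · have hF' := hF
    obtain ⟨hHSY, hCM0, hmod, -⟩ := hF'
    exact (SylvesterTwoUpper.missingLowerBoundAt_iff_pairBound hHSY hCM0 hmod hp h9 h3 A B hB hA).mpr
      (h hF p hp h9 h3 A B hB hA hV)

/-! ## §3 Under the route's pair parity `TwoAdicPairHSY` (item 19580, by name) -/

/-- **The `𝒱₀` child ⟺ «`n(p) = 0` on `𝒱₀`», granted `TwoAdicPairHSY`** (`ord₂(qB·qA) = 2n` with
`n ∈ ℕ`, so `≤ 0` forces `= 0`): this is p457106's displayed `hon` — on `𝒱₀`, Hu–Shu–Yin's pair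
product is a `2`-ADIC UNIT. [cite: HuShuYin2019, Cor. 4.4 and (bsd) p. 12]
[cite: BurungaleFlach2024, Thm. 1.1 and Cor. 2] [cite: Miller2011LMS, Def. 1.1] -/
theorem lowerOnV0_iff_pairUnit_of_twoAdicPair (hBC : TwoAdicPairHSY) :
    (PublishedFactsTwo → ∀ (p : ℕ), p.Prime → (p % 9 = 4 ∨ p % 9 = 7) →
        (¬ ∃ x : ZMod p, x ^ 3 = 3) →
        ∀ (A B : WeierstrassCurve ℚ) [A.IsElliptic] [A.IsGloballyMinimal] [B.IsElliptic]
          [B.IsGloballyMinimal], (∃ C : VariableChange ℚ, C • B = cubeSumCurve (p : ℚ)) →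
          (∃ C : VariableChange ℚ, C • A = cubeSumCurve (3 * (p : ℚ) ^ 2)) →
          (Nat.card (AddCommGroup.primaryComponent B.sha 2) = 1 ∧
            Nat.card (AddCommGroup.primaryComponent A.sha 2) = 1) →
          MissingLowerBoundAt B 2) ↔
      (PublishedFactsTwo → ∀ (p : ℕ), p.Prime → (p % 9 = 4 ∨ p % 9 = 7) →
        (¬ ∃ x : ZMod p, x ^ 3 = 3) →
        ∀ (A B : WeierstrassCurve ℚ) [A.IsElliptic] [A.IsGloballyMinimal] [B.IsElliptic]
          [B.IsGloballyMinimal], (∃ C : VariableChange ℚ, C • B = cubeSumCurve (p : ℚ)) →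
          (∃ C : VariableChange ℚ, C • A = cubeSumCurve (3 * (p : ℚ) ^ 2)) →
          (Nat.card (AddCommGroup.primaryComponent B.sha 2) = 1 ∧
            Nat.card (AddCommGroup.primaryComponent A.sha 2) = 1) →
          ∃ qB qA : ℚ, shaAn B = (qB : ℂ) ∧ shaAn A = (qA : ℂ) ∧ padicValRat 2 (qB * qA) = 0) := by
  rw [lowerOnV0_iff_pairLeZero]
  refine ⟨fun h hF p hp h9 h3 A B _ _ _ _ hB hA hV => ?_, fun h hF p hp h9 h3 A B _ _ _ _ hB hA hV => ?_⟩
  · obtain ⟨qB, qA, hqB, hqA, hne, hle⟩ := h hF p hp h9 h3 A B hB hA hV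
    obtain ⟨qB', qA', hqB', hqA', -, n, hn⟩ := hBC p hp h9 h3 A B hB hA
    have hqq : qB' = qB := by exact_mod_cast hqB'.symm.trans hqB
    have hqq' : qA' = qA := by exact_mod_cast hqA'.symm.trans hqA
    subst hqq hqq'
    refine ⟨qB', qA', hqB, hqA, ?_⟩
    rw [hn] at hle ⊢
    have : (n : ℤ) = 0 := by exact_mod_cast (show (n : ℤ) ≤ 0 by linarith).antisymm (by positivity)
    rw [this, mul_zero]
  · obtain ⟨qB, qA, hqB, hqA, h0⟩ := h hF p hp h9 h3 A B hB hA hV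
    have hF' := hF
    obtain ⟨hHSY, hCM0, hmod, -⟩ := hF'
    obtain ⟨-, -, qB', qA', hqB', hqA', hqB0, hqA0, -⟩ :=
      SylvesterTwoUpper.pair_shaAn_two hHSY hCM0 hmod hp h9 h3 A B hB hA
    have hqq : qB' = qB := by exact_mod_cast hqB'.symm.trans hqB
    have hqq' : qA' = qA := by exact_mod_cast hqA'.symm.trans hqA
    subst hqq hqq'
    exact ⟨qB', qA', hqB, hqA, mul_ne_zero hqB0 hqA0, h0.le⟩

/-- **ONE BIT FREE on `𝒱₀`.** Granted Cassels–Tate (`exists_casselsTate_pairing`, named fact) and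
`TwoAdicPairHSY`: if on `𝒱₀` the pair product has `ord₂ ≤ 1`, the `𝒱₀` child holds (p465001:
both sides even). So a split may state the `𝒱₀` child as «`ord₂(qB·qA) ≤ 1`».
[cite: SilvermanAEC2009, Thm. X.4.14] [cite: HuShuYin2019, Cor. 4.4 and (bsd) p. 12]
[cite: BurungaleFlach2024, Thm. 1.1 and Cor. 2] [cite: Miller2011LMS, Def. 1.1] -/
theorem lowerOnV0_of_pairLeOne (hCT : WeierstrassCurve.exists_casselsTate_pairing (K := ℚ))
    (hBC : TwoAdicPairHSY)
    (h : PublishedFactsTwo → ∀ (p : ℕ), p.Prime → (p % 9 = 4 ∨ p % 9 = 7) →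
        (¬ ∃ x : ZMod p, x ^ 3 = 3) →
        ∀ (A B : WeierstrassCurve ℚ) [A.IsElliptic] [A.IsGloballyMinimal] [B.IsElliptic]
          [B.IsGloballyMinimal], (∃ C : VariableChange ℚ, C • B = cubeSumCurve (p : ℚ)) →
          (∃ C : VariableChange ℚ, C • A = cubeSumCurve (3 * (p : ℚ) ^ 2)) →
          (Nat.card (AddCommGroup.primaryComponent B.sha 2) = 1 ∧
            Nat.card (AddCommGroup.primaryComponent A.sha 2) = 1) →
          ∃ qB qA : ℚ, shaAn B = (qB : ℂ) ∧ shaAn A = (qA : ℂ) ∧ qB * qA ≠ 0 ∧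
            padicValRat 2 (qB * qA) ≤ 1) :
    PublishedFactsTwo → ∀ (p : ℕ), p.Prime → (p % 9 = 4 ∨ p % 9 = 7) →
        (¬ ∃ x : ZMod p, x ^ 3 = 3) →
        ∀ (A B : WeierstrassCurve ℚ) [A.IsElliptic] [A.IsGloballyMinimal] [B.IsElliptic]
          [B.IsGloballyMinimal], (∃ C : VariableChange ℚ, C • B = cubeSumCurve (p : ℚ)) →
          (∃ C : VariableChange ℚ, C • A = cubeSumCurve (3 * (p : ℚ) ^ 2)) →
          (Nat.card (AddCommGroup.primaryComponent B.sha 2) = 1 ∧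
            Nat.card (AddCommGroup.primaryComponent A.sha 2) = 1) →
          MissingLowerBoundAt B 2 := by
  intro hF p hp h9 h3 A B _ _ _ _ hB hA hV
  have hF' := hF
  obtain ⟨hHSY, hCM0, hmod, -⟩ := hF'
  obtain ⟨qB, qA, hqB, hqA, hne, hle⟩ := h hF p hp h9 h3 A B hB hA hV
  refine SylvesterTwoOneBit.missingLowerBoundAt_of_pairBound_add_one hHSY hCM0 hmod hCT hBC hp h9 h3
    A B hB hA ⟨qB, qA, hqB, hqA, hne, ?_⟩
  rw [hV.1, hV.2]
  simpa using hle

/-- **ONE BIT FREE off `𝒱₀`.** Granted Cassels–Tate and `TwoAdicPairHSY`: if off `𝒱₀` the pair bound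
holds up to one bit (`ord₂(qB·qA) ≤ s_B + s_A + 1`), the off-`𝒱₀` child holds (p465001). So a split
may state the off-`𝒱₀` child with constant `2¹`. [cite: SilvermanAEC2009, Thm. X.4.14]
[cite: HuShuYin2019, Cor. 4.4 and (bsd) p. 12] [cite: BurungaleFlach2024, Thm. 1.1 and Cor. 2]
[cite: Miller2011LMS, Def. 1.1] -/
theorem lowerOffV0_of_pairBound_add_one (hCT : WeierstrassCurve.exists_casselsTate_pairing (K := ℚ))
    (hBC : TwoAdicPairHSY)
    (h : PublishedFactsTwo → ∀ (p : ℕ), p.Prime → (p % 9 = 4 ∨ p % 9 = 7) →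
        (¬ ∃ x : ZMod p, x ^ 3 = 3) →
        ∀ (A B : WeierstrassCurve ℚ) [A.IsElliptic] [A.IsGloballyMinimal] [B.IsElliptic]
          [B.IsGloballyMinimal], (∃ C : VariableChange ℚ, C • B = cubeSumCurve (p : ℚ)) →
          (∃ C : VariableChange ℚ, C • A = cubeSumCurve (3 * (p : ℚ) ^ 2)) →
          ¬ (Nat.card (AddCommGroup.primaryComponent B.sha 2) = 1 ∧
            Nat.card (AddCommGroup.primaryComponent A.sha 2) = 1) →
          ∃ qB qA : ℚ, shaAn B = (qB : ℂ) ∧ shaAn A = (qA : ℂ) ∧ qB * qA ≠ 0 ∧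
            padicValRat 2 (qB * qA) ≤
              (padicValNat 2 (Nat.card (AddCommGroup.primaryComponent B.sha 2)) : ℤ) +
                (padicValNat 2 (Nat.card (AddCommGroup.primaryComponent A.sha 2)) : ℤ) + 1) :
    PublishedFactsTwo → ∀ (p : ℕ), p.Prime → (p % 9 = 4 ∨ p % 9 = 7) →
        (¬ ∃ x : ZMod p, x ^ 3 = 3) →
        ∀ (A B : WeierstrassCurve ℚ) [A.IsElliptic] [A.IsGloballyMinimal] [B.IsElliptic]
          [B.IsGloballyMinimal], (∃ C : VariableChange ℚ, C • B = cubeSumCurve (p : ℚ)) →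
          (∃ C : VariableChange ℚ, C • A = cubeSumCurve (3 * (p : ℚ) ^ 2)) →
          ¬ (Nat.card (AddCommGroup.primaryComponent B.sha 2) = 1 ∧
            Nat.card (AddCommGroup.primaryComponent A.sha 2) = 1) →
          MissingLowerBoundAt B 2 := by
  intro hF p hp h9 h3 A B _ _ _ _ hB hA hV
  have hF' := hF
  obtain ⟨hHSY, hCM0, hmod, -⟩ := hF'
  exact SylvesterTwoOneBit.missingLowerBoundAt_of_pairBound_add_one hHSY hCM0 hmod hCT hBC hp h9 h3
    A B hB hA (h hF p hp h9 h3 A B hB hA hV)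

end SylvesterTwoLowerSplit

end Summit.BirchSwinnertonDyer.BirchSwinnertonDyer.Theorems

end
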